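import Literature.Analysis.FluidPDE.SereginSverakMeridionalCubic
import HarnessLib

/-!
# Seregin–Šverák 2009, Lemma 3.5 with the Type I rate on the meridional velocity only

G. Seregin, V. Šverák, *On Type I singularities of the local axi-symmetric solutions of the
Navier–Stokes equations*, Comm. PDE 34 (2009) 171–201 = arXiv:0804.1803 (labels and pages refer
to the arXiv version). Lemma 3.5 (p. 9): "Under assumptions of Theorem 3.1, we have the estimate
(as4) `A(z_b,r;v) + E(z_b,r;v) + C(z_b,r;v) + D(z_b,r;q) ≤ C₁ < +∞` for all `z_b = (b e₃, 0)`,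
`|b| ≤ 1/4`, `0 < r < 1/4`. A constant `C₁` depends only on the constant `C` in (r3), `‖v‖_{L₃(Q)}`,
and `‖q‖_{L_{3/2}(Q)}`." Its printed proof (pp. 9–10) uses the Type I rate ONLY through the
meridional part `v̄ = v_ϱ e_ϱ + v₃ e₃` ((as9)), the azimuthal part `v̂ = v_φ e_φ` being controlled by
the swirl bound (as7) `|x'||v_φ| ≤ C₂` of Lemma 3.3 — which is why the paper's §1 states the result
(Theorem 1.1) with the rate (1.1) on `v̄` alone (tree: the named fact
`SereginSverak2009.MeridionalTypeIRegularity`).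

The tree's discharge `SereginSverak2009.ScaledEnergyBound_holds` takes the rate (r3) on the whole
field (through the shortcut `CubicAbsorption_holds`). This file PROVES Lemma 3.5 under

* the standing assumptions of §3 with axial symmetry (`IsAxisymmetricLocalSolution`),
* (r2) `v ∈ L_∞(𝒞 × ]-1,-a²[)`, `0 < a < 1` (`IsBoundedAwayFromZero`; the hypothesis under which
  Remark 3.4 — suitability, the weak gradient `∇v ∈ L²_loc(Q)` — is available),
* (1.1) the Type I rate on the MERIDIONAL part, `√(-t) ‖ū(t,x)‖ ≤ C` a.e. on `Q`,
* (as7) the swirl bound `|Γ(t,x)| ≤ C₂` a.e. on `Q` (`Γ = |x'| u_φ`) — an INPUT here (in print the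
  output of Lemma 3.3, App. II; for classical solutions it is the maximum principle for `Γ`),

with the printed uniformity: `C₁ = C₁(C, C₂, N₁, N₂)` for `∫_Q|v|³ ≤ N₁`, `∫_Q|q|^{3/2} ≤ N₂`
(`SereginSverak2009.scaledEnergyBound_meridional`). Proof "as printed": (as6)/Remark 3.4 =
`exists_hasWeakSpatialGradientOn_energy_lt_top` (under (r2)), (as11) =
`cubicC_le_eps_meridional` (`SereginSverakMeridionalCubic.lean`, doubled radius), (as12) =
`localEnergy36`, (as13) = `pressureDecay36`, and the iteration `ℰ(ϑr) ≤ ½ℰ(r) + f₃` through the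
tree's `decay_step_half36` / `iterate_halving` — verbatim the assembly of
`ScaledEnergyBound36_holds` (`SereginSverakBlowupDecayProofs.lean`) with (r4) replaced by
(1.1) + (as7). No named facts; nothing about blow-up is asserted.

## References

* G. Seregin, V. Šverák, Comm. PDE 34 (2009) 171–201, arXiv:0804.1803: §1 (1.1), Thm 1.1 (pp. 2–3);
  §3 Lemma 3.3 (as1), Remark 3.4, Lemma 3.5 and its proof (as4)–(as13) (pp. 9–10).
  [`SereginSverak2009`]
-/

noncomputable section

open MeasureTheory Set Function Filter Topology TopologicalSpace Module
open scoped NNReal ENNReal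

namespace Literature.Analysis.FluidPDE

namespace SereginSverak2009

/-- **Seregin–Šverák 2009, Lemma 3.5 under the meridional Type I rate (1.1) and the swirl bound
(as7).** For all numbers `C, C₂, N₁, N₂` there is ONE `C₁` such that for every pair `(u, p)`
satisfying the standing assumptions of §3 with axial symmetry, (r2), the rate
`√(-t) ‖ū(t, x)‖ ≤ C` a.e. on `Q` on the meridional part `ū = poloidalPart (u t)`, the swirl bound
`|Γ(t, x)| ≤ C₂` a.e. on `Q` (`Γ = swirl (u t)`), `∫_Q |u|³ ≤ N₁` and `∫_Q |p|^{3/2} ≤ N₂`, there is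
a weak spatial gradient `G = ∇u` on `Q` (Remark 3.4) with
`A(z_b,r;u) + E(z_b,r;G) + C(z_b,r;u) + D(z_b,r;p) ≤ C₁` for all `z_b = (b e₃, 0)`, `|b| ≤ 1/4`,
`0 < r < 1/4` — display (as4) with the printed dependence `C₁ = C₁(C, C₂, ‖v‖₃, ‖q‖_{3/2})`
("Constant `C₂` depends on the same arguments as constant `C₁`", p. 9). Proof as printed
(pp. 9–10), module docstring. [cite: SereginSverak2009, Lemma 3.5 (arXiv p. 9) and its proof (as6)–(as13) (pp. 9–10), with (1.1) (p. 2)] -/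
theorem scaledEnergyBound_meridional (C C₂ N₁ N₂ : ℝ) :
    ∃ C₁ : ℝ≥0, ∀ (u : ℝ → EuclideanSpace ℝ (Fin 3) → EuclideanSpace ℝ (Fin 3))
      (p : ℝ → EuclideanSpace ℝ (Fin 3) → ℝ),
      IsAxisymmetricLocalSolution u p → IsBoundedAwayFromZero u →
      (∀ᵐ z ∂(volume.restrict (parCyl 0 1)),
        Real.sqrt (-z.1) * ‖poloidalPart (u z.1) z.2‖ ≤ C) →
      (∀ᵐ z ∂(volume.restrict (parCyl 0 1)), |swirl (u z.1) z.2| ≤ C₂) →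
      (∫⁻ z in parCyl 0 1, ‖u z.1 z.2‖ₑ ^ (3 : ℕ) ≤ ENNReal.ofReal N₁) →
      (∫⁻ z in parCyl 0 1, ‖p z.1 z.2‖ₑ ^ (3 / 2 : ℝ) ≤ ENNReal.ofReal N₂) →
      ∃ G : ℝ → EuclideanSpace ℝ (Fin 3) → EuclideanSpace ℝ (Fin 3) →L[ℝ] EuclideanSpace ℝ (Fin 3),
        HasWeakSpatialGradientOn (parCylOpens 0 1) u G ∧
        ∀ b : ℝ, |b| ≤ 1 / 4 → ∀ r ∈ Ioo (0 : ℝ) (1 / 4),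
          energyA ((0 : ℝ), b • eZ) r u + dissipationE ((0 : ℝ), b • eZ) r G +
            cubicC ((0 : ℝ), b • eZ) r u + pressureD ((0 : ℝ), b • eZ) r p ≤ C₁ := by
  obtain ⟨c₁₂, h12⟩ := localEnergy36
  obtain ⟨c₁₃, h13⟩ := pressureDecay36
  -- constants depending on `c₁₂, c₁₃` only
  set K : ℝ≥0 := max c₁₂ c₁₃ with hK
  have hK12 : (c₁₂ : ℝ≥0∞) ≤ K := ENNReal.coe_le_coe.2 (le_max_left _ _)
  have hK13 : (c₁₃ : ℝ≥0∞) ≤ K := ENNReal.coe_le_coe.2 (le_max_right _ _)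
  obtain ⟨ϑ, hϑ0, -, hLϑ⟩ := exists_ratio (8 * (2 * K ^ 2 + K) + 4)
  have hϑR : (0 : ℝ) < ϑ := by exact_mod_cast hϑ0
  have hKR : (0 : ℝ) ≤ K := K.coe_nonneg
  have hLϑR : (8 * (2 * (K : ℝ) ^ 2 + K) + 4) * ϑ ≤ 2⁻¹ := by
    have h := NNReal.coe_le_coe.2 hLϑ
    push_cast at h
    exact h
  have hprod : 0 ≤ (2 * (K : ℝ) ^ 2 + K) * ϑ := by positivity
  have hϑ8R : 8 * (ϑ : ℝ) ≤ 1 := by nlinarith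
  have hKϑR : (2 * (K : ℝ) ^ 2 + K) * (8 * ϑ) ≤ 2⁻¹ := by nlinarith
  have hϑ8 : 8 * ϑ ≤ 1 := by
    rw [← NNReal.coe_le_coe]; push_cast; exact hϑ8R
  have hKϑ : (2 * K ^ 2 + K) * (8 * ϑ) ≤ 2⁻¹ := by
    rw [← NNReal.coe_le_coe]; push_cast; exact hKϑR
  have hϑ1R : (ϑ : ℝ) < 1 := by linarith
  obtain ⟨ε, hε0, hKε⟩ := exists_parameter ((6 * K + K ^ 2) * (4 * ϑ)⁻¹ ^ 2)
  -- the constant of (as11), depending on `ε`, `C` and `C₂` only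
  obtain ⟨F, hF⟩ := cubicC_le_eps_meridional C C₂ hε0
  -- the top scales `r₀ ≤ r < 1/4`, `r₀ = ϑ/4`, and their bound `M = M(K, ϑ, N₁, N₂)`
  set r₀ : ℝ := (ϑ : ℝ) * (1 / 4) with hr₀
  have hr₀0 : 0 < r₀ := by positivity
  set T₁ : ℝ≥0∞ := ENNReal.ofReal ((1 / (2 * r₀)) ^ 2) * ENNReal.ofReal N₁ with hT₁
  set T₂ : ℝ≥0∞ := ENNReal.ofReal ((1 / (2 * r₀)) ^ 2) * ENNReal.ofReal N₂ with hT₂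
  set T₃ : ℝ≥0∞ := ENNReal.ofReal ((1 / r₀) ^ 2) * ENNReal.ofReal N₂ with hT₃
  set M : ℝ≥0∞ := K * (T₁ ^ (2 / 3 : ℝ) + T₁ + T₂) + T₃ with hM
  have hT₁t : T₁ ≠ ⊤ := ENNReal.mul_ne_top ENNReal.ofReal_ne_top ENNReal.ofReal_ne_top
  have hT₂t : T₂ ≠ ⊤ := ENNReal.mul_ne_top ENNReal.ofReal_ne_top ENNReal.ofReal_ne_top
  have hT₃t : T₃ ≠ ⊤ := ENNReal.mul_ne_top ENNReal.ofReal_ne_top ENNReal.ofReal_ne_top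
  have hMt : M ≠ ⊤ := by
    refine ENNReal.add_ne_top.2 ⟨ENNReal.mul_ne_top ENNReal.coe_ne_top ?_, hT₃t⟩
    exact ENNReal.add_ne_top.2 ⟨ENNReal.add_ne_top.2
      ⟨ENNReal.rpow_ne_top_of_nonneg (by norm_num) hT₁t, hT₁t⟩, hT₂t⟩
  set B : ℝ≥0 := (6 * K + K ^ 2) * (4 * ϑ)⁻¹ ^ 2 * F + K * (4 * ϑ)⁻¹ ^ 2 with hB
  -- the crude bound for `C(z_b, r)`, `r ≥ 1/8`
  set T₄ : ℝ≥0∞ := ENNReal.ofReal ((1 / (1 / 8 : ℝ)) ^ 2) * ENNReal.ofReal N₁ with hT₄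
  have hT₄t : T₄ ≠ ⊤ := ENNReal.mul_ne_top ENNReal.ofReal_ne_top ENNReal.ofReal_ne_top
  -- the final constant
  have hTot : M + 2 * B + (ε * (M + 2 * B) + F + T₄) ≠ ⊤ := by
    have hMB : M + 2 * B ≠ ⊤ := ENNReal.add_ne_top.2 ⟨hMt, by finiteness⟩
    exact ENNReal.add_ne_top.2 ⟨hMB, ENNReal.add_ne_top.2 ⟨ENNReal.add_ne_top.2
      ⟨ENNReal.mul_ne_top (by finiteness) hMB, by finiteness⟩, hT₄t⟩⟩
  refine ⟨(M + 2 * B + (ε * (M + 2 * B) + F + T₄)).toNNReal, ?_⟩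
  -- the solution
  intro u p hsol hr2 hrate hsw hN₁ hN₂
  obtain ⟨G, hG, -⟩ := exists_hasWeakSpatialGradientOn_energy_lt_top hsol.distributional
    hsol.velocity_L3 hsol.pressure_L32 hr2
  refine ⟨G, hG, ?_⟩
  rw [ENNReal.coe_toNNReal hTot]
  -- the global quantities
  have hC1 : cubicC 0 1 u ≤ ENNReal.ofReal N₁ := by
    simpa [cubicC] using hN₁
  have hD1 : pressureD 0 1 p ≤ ENNReal.ofReal N₂ := by
    simpa [pressureD] using hN₂
  -- `ℰ_b ≤ M + 2B` on `(0, 1/4)`, uniformly in `|b| ≤ 1/4`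
  have hΦ : ∀ b : ℝ, |b| ≤ 1 / 4 → ∀ r ∈ Ioo (0 : ℝ) (1 / 4),
      dissipationE ((0 : ℝ), b • eZ) r G + energyA ((0 : ℝ), b • eZ) r u +
        pressureD ((0 : ℝ), b • eZ) r p ≤ M + 2 * B := by
    intro b hb r hr
    refine iterate_halving (Φ := fun r => dissipationE ((0 : ℝ), b • eZ) r G +
        energyA ((0 : ℝ), b • eZ) r u + pressureD ((0 : ℝ), b • eZ) r p)
      (R := 1 / 4) hϑR hϑ1R hr₀0 le_rfl ?_ ?_ hr.1 hr.2
    · -- the contraction `ℰ_b(ϑ r) ≤ ½ ℰ_b(r) + B`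
      intro r hr0 hrR
      refine decay_step_half36 (E := fun r => dissipationE ((0 : ℝ), b • eZ) r G)
        (A := fun r => energyA ((0 : ℝ), b • eZ) r u)
        (C := fun r => cubicC ((0 : ℝ), b • eZ) r u)
        (D := fun r => pressureD ((0 : ℝ), b • eZ) r p) hϑ0 hϑ8 hKϑ hKε ?_ ?_ ?_ ?_ ?_
        ⟨hr0, hrR⟩
      · -- (as11) at radius `r/2`
        intro r hr
        have h := hF u G hG hrate hsw b hb (r / 2) (by linarith [hr.1]) (by linarith [hr.2])
        have e : 2 * (r / 2) = r := by ring
        rw [e] at h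
        exact h
      · -- (as12)
        intro r hr
        exact (h12 u p hsol hr2 G hG b hb r hr.1 (by linarith [hr.2])).trans (by gcongr)
      · -- (as13)
        intro r hr κ hκ hκ1
        exact (pressureD_mul_le_of_decay (h13 u p hsol b hb) hr hκ hκ1).trans (by gcongr)
      · -- scaling of `C`
        intro r hr κ hκ hκ1
        exact cubicC_mul_le _ u hr.1 hκ hκ1
      · -- monotonicity of `D`
        intro r hr
        have hr0' : r ≠ 0 := hr.1.ne'
        have hsub : parCyl ((0 : ℝ), b • eZ) (r / 2) ⊆ parCyl ((0 : ℝ), b • eZ) r :=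
          parCyl_mono _ (by linarith [hr.1]) (by linarith [hr.1])
        have e : (r / (r / 2)) ^ 2 = 4 := by
          rw [div_div_eq_mul_div, mul_div_right_comm, div_self hr0', one_mul]; norm_num
        calc pressureD ((0 : ℝ), b • eZ) (r / 2) p
            ≤ ENNReal.ofReal ((r / (r / 2)) ^ 2) * pressureD ((0 : ℝ), b • eZ) r p :=
              pressureD_le_of_subset (by linarith [hr.1]) hr.1 hsub
          _ = 4 * pressureD ((0 : ℝ), b • eZ) r p := by rw [e, ENNReal.ofReal_ofNat]
    · -- the top scales, through (as12) at radius `2r` and `Q(z_b, 2r) ⊆ Q`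
      intro r h1 h2
      have hr0 : 0 < r := hr₀0.trans_le h1
      have h2r : 0 < 2 * r := by positivity
      have hsub2 : parCyl ((0 : ℝ), b • eZ) (2 * r) ⊆ parCyl 0 1 :=
        parCyl_axis_subset h2r.le (by linarith)
      have hsub1 : parCyl ((0 : ℝ), b • eZ) r ⊆ parCyl 0 1 :=
        parCyl_axis_subset hr0.le (by linarith [abs_nonneg b])
      have hratio2 : (1 / (2 * r)) ^ 2 ≤ (1 / (2 * r₀)) ^ 2 := by
        have : 1 / (2 * r) ≤ 1 / (2 * r₀) := one_div_le_one_div_of_le (by positivity) (by linarith)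
        exact pow_le_pow_left₀ (by positivity) this 2
      have hratio1 : (1 / r) ^ 2 ≤ (1 / r₀) ^ 2 := by
        have : 1 / r ≤ 1 / r₀ := one_div_le_one_div_of_le hr₀0 h1
        exact pow_le_pow_left₀ (by positivity) this 2
      have hCT : cubicC ((0 : ℝ), b • eZ) (2 * r) u ≤ T₁ := by
        calc cubicC ((0 : ℝ), b • eZ) (2 * r) u
            ≤ ENNReal.ofReal ((1 / (2 * r)) ^ 2) * cubicC 0 1 u :=
              cubicC_le_of_subset h2r one_pos hsub2
          _ ≤ ENNReal.ofReal ((1 / (2 * r₀)) ^ 2) * ENNReal.ofReal N₁ := by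
              gcongr
      have hDT : pressureD ((0 : ℝ), b • eZ) (2 * r) p ≤ T₂ := by
        calc pressureD ((0 : ℝ), b • eZ) (2 * r) p
            ≤ ENNReal.ofReal ((1 / (2 * r)) ^ 2) * pressureD 0 1 p :=
              pressureD_le_of_subset h2r one_pos hsub2
          _ ≤ ENNReal.ofReal ((1 / (2 * r₀)) ^ 2) * ENNReal.ofReal N₂ := by
              gcongr
      have hDT' : pressureD ((0 : ℝ), b • eZ) r p ≤ T₃ := by
        calc pressureD ((0 : ℝ), b • eZ) r p
            ≤ ENNReal.ofReal ((1 / r) ^ 2) * pressureD 0 1 p :=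
              pressureD_le_of_subset hr0 one_pos hsub1
          _ ≤ ENNReal.ofReal ((1 / r₀) ^ 2) * ENNReal.ofReal N₂ := by
              gcongr
      have hEA : dissipationE ((0 : ℝ), b • eZ) r G + energyA ((0 : ℝ), b • eZ) r u ≤
          K * (T₁ ^ (2 / 3 : ℝ) + T₁ + T₂) := by
        have h := h12 u p hsol hr2 G hG b hb (2 * r) h2r (by linarith)
        have e : 2 * r / 2 = r := by ring
        rw [e] at h
        calc dissipationE ((0 : ℝ), b • eZ) r G + energyA ((0 : ℝ), b • eZ) r u
            ≤ c₁₂ * (cubicC ((0 : ℝ), b • eZ) (2 * r) u ^ (2 / 3 : ℝ) +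
                cubicC ((0 : ℝ), b • eZ) (2 * r) u + pressureD ((0 : ℝ), b • eZ) (2 * r) p) := h
          _ ≤ K * (T₁ ^ (2 / 3 : ℝ) + T₁ + T₂) := by gcongr
      calc dissipationE ((0 : ℝ), b • eZ) r G + energyA ((0 : ℝ), b • eZ) r u +
            pressureD ((0 : ℝ), b • eZ) r p
          ≤ K * (T₁ ^ (2 / 3 : ℝ) + T₁ + T₂) + T₃ := add_le_add hEA hDT'
        _ = M := by rw [hM]
  -- the cubic term: (as11) for `r < 1/8`, the inclusion `Q(z_b, r) ⊆ Q` for `r ≥ 1/8`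
  have hCub : ∀ b : ℝ, |b| ≤ 1 / 4 → ∀ r ∈ Ioo (0 : ℝ) (1 / 4),
      cubicC ((0 : ℝ), b • eZ) r u ≤ ε * (M + 2 * B) + F + T₄ := by
    intro b hb r hr
    rcases lt_or_ge r (1 / 8) with h8 | h8
    · have h := hF u G hG hrate hsw b hb r hr.1 (by linarith)
      have h2r : 2 * r ∈ Ioo (0 : ℝ) (1 / 4) := ⟨by linarith [hr.1], by linarith⟩
      have hEA : dissipationE ((0 : ℝ), b • eZ) (2 * r) G + energyA ((0 : ℝ), b • eZ) (2 * r) u ≤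
          M + 2 * B := le_self_add.trans (hΦ b hb (2 * r) h2r)
      calc cubicC ((0 : ℝ), b • eZ) r u
          ≤ ε * (dissipationE ((0 : ℝ), b • eZ) (2 * r) G + energyA ((0 : ℝ), b • eZ) (2 * r) u) +
              F := h
        _ ≤ ε * (M + 2 * B) + F := by gcongr
        _ ≤ ε * (M + 2 * B) + F + T₄ := le_self_add
    · have hsub1 : parCyl ((0 : ℝ), b • eZ) r ⊆ parCyl 0 1 :=
        parCyl_axis_subset hr.1.le (by linarith [hr.2])
      have hratio : (1 / r) ^ 2 ≤ (1 / (1 / 8 : ℝ)) ^ 2 := by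
        have : 1 / r ≤ 1 / (1 / 8 : ℝ) := one_div_le_one_div_of_le (by norm_num) h8
        exact pow_le_pow_left₀ (by positivity) this 2
      calc cubicC ((0 : ℝ), b • eZ) r u
          ≤ ENNReal.ofReal ((1 / r) ^ 2) * cubicC 0 1 u := cubicC_le_of_subset hr.1 one_pos hsub1
        _ ≤ ENNReal.ofReal ((1 / (1 / 8 : ℝ)) ^ 2) * ENNReal.ofReal N₁ := by gcongr
        _ = T₄ := by rw [hT₄]
        _ ≤ ε * (M + 2 * B) + F + T₄ := le_add_self
  -- conclusion
  intro b hb r hr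
  have h1 := hΦ b hb r hr
  have h2 := hCub b hb r hr
  calc energyA ((0 : ℝ), b • eZ) r u + dissipationE ((0 : ℝ), b • eZ) r G +
        cubicC ((0 : ℝ), b • eZ) r u + pressureD ((0 : ℝ), b • eZ) r p
      = (dissipationE ((0 : ℝ), b • eZ) r G + energyA ((0 : ℝ), b • eZ) r u +
          pressureD ((0 : ℝ), b • eZ) r p) + cubicC ((0 : ℝ), b • eZ) r u := by ring
    _ ≤ (M + 2 * B) + (ε * (M + 2 * B) + F + T₄) := add_le_add h1 h2

/-- **Lemma 3.5 under (1.1) and (as7), per solution**: under the standing assumptions of §3 with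
axial symmetry, (r2), the meridional rate (1.1) (`IsMeridionalTypeIOnCyl`) and a swirl bound
`|Γ| ≤ C₂` a.e. on `Q`, there are a weak spatial gradient `G = ∇u` on `Q` and `C₁` with
`A + E + C + D ≤ C₁` at all `z_b = (b e₃, 0)`, `|b| ≤ 1/4`, `0 < r < 1/4` (the uniform constant of
`scaledEnergyBound_meridional` at `N₁ = ∫_Q|u|³`, `N₂ = ∫_Q|p|^{3/2}`).
[cite: SereginSverak2009, Lemma 3.5 (arXiv p. 9), with (1.1) (p. 2) and (as7) (p. 9)] -/
theorem exists_scaledEnergyBound_meridional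
    {u : ℝ → EuclideanSpace ℝ (Fin 3) → EuclideanSpace ℝ (Fin 3)}
    {p : ℝ → EuclideanSpace ℝ (Fin 3) → ℝ}
    (hsol : IsAxisymmetricLocalSolution u p) (hr2 : IsBoundedAwayFromZero u)
    (hmer : IsMeridionalTypeIOnCyl u)
    (hsw : ∃ C₂ : ℝ, ∀ᵐ z ∂(volume.restrict (parCyl 0 1)), |swirl (u z.1) z.2| ≤ C₂) :
    ∃ G : ℝ → EuclideanSpace ℝ (Fin 3) → EuclideanSpace ℝ (Fin 3) →L[ℝ] EuclideanSpace ℝ (Fin 3),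
      HasWeakSpatialGradientOn (parCylOpens 0 1) u G ∧
      ∃ C₁ : ℝ≥0, ∀ b : ℝ, |b| ≤ 1 / 4 → ∀ r ∈ Ioo (0 : ℝ) (1 / 4),
        energyA ((0 : ℝ), b • eZ) r u + dissipationE ((0 : ℝ), b • eZ) r G +
          cubicC ((0 : ℝ), b • eZ) r u + pressureD ((0 : ℝ), b • eZ) r p ≤ C₁ := by
  obtain ⟨C, hC⟩ := hmer
  obtain ⟨C₂, hC₂⟩ := hsw
  set N₁ : ℝ := (∫⁻ z in parCyl 0 1, ‖u z.1 z.2‖ₑ ^ (3 : ℕ)).toReal with hN₁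
  set N₂ : ℝ := (∫⁻ z in parCyl 0 1, ‖p z.1 z.2‖ₑ ^ (3 / 2 : ℝ)).toReal with hN₂
  have hN₁' : ∫⁻ z in parCyl 0 1, ‖u z.1 z.2‖ₑ ^ (3 : ℕ) ≤ ENNReal.ofReal N₁ := by
    rw [hN₁, ENNReal.ofReal_toReal hsol.velocity_L3.ne]
  have hN₂' : ∫⁻ z in parCyl 0 1, ‖p z.1 z.2‖ₑ ^ (3 / 2 : ℝ) ≤ ENNReal.ofReal N₂ := by
    rw [hN₂, ENNReal.ofReal_toReal hsol.pressure_L32.ne]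
  obtain ⟨C₁, hC₁⟩ := scaledEnergyBound_meridional C C₂ N₁ N₂
  obtain ⟨G, hG, hbound⟩ := hC₁ u p hsol hr2 hC hC₂ hN₁' hN₂'
  exact ⟨G, hG, C₁, hbound⟩

end SereginSverak2009

end Literature.Analysis.FluidPDE
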